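import Summits.QuantumFields.QCD.Theorems.QuarksAsStableActionStableActionBridgeChainBlockDet
import Summits.QuantumFields.QCD.Theorems.QuarksAsStableActionStableActionBridgeAPChainBlockPos
import Summits.QuantumFields.QCD.Theorems.QuarksAsStableActionStableActionBridgeSliceMassHopDict

/-!
# The chain-block prefactor of the Wilson fermion determinant in Smit's slice vocabulary
(crux `QuarksAsStableAction.StableActionBridge`, item stmt-QuantumFields-9737, line `Sketch`; lead assembly of
continuation lead c6, cycle 7, `--supports stmt-QuantumFields-9737`; registered sub-goal
`det_chainBlock_eq_det_sliceMassHop_sq`)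

Lüscher's transfer-matrix form of the Wilson fermion determinant of a four-torus `SU(3)` gauge field
(`wilson_det_transfer_form`, p120730) carries the prefactor `∏_t det E_t`, `E_t = A_t P⁻ − P⁺ W′_{t−1}` the chain
blocks of the time-slice reduction, and `det E_t = det(w′_{t−1})² · det(B_t)²` (`det_wilson_chainBlock`, p121347) with
`w′_{t−1}` the site-block-diagonal colour matrix of the inverse temporal links and `B_t` the spin-blind slice block.
For the defining representation of `SU(3)` the colour blocks have determinant one, and `B_t` IS Smit's
mass-plus-hop matrix `A(U_t) = sliceMassHop U_t m` of the slice configuration `U_t(x⃗, j) = U((t, x⃗), j+1)`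
(dictionary `sliceMassHop_timeSlice_apply`, p127509).  Hence

* `det_chainBlock_eq_det_sliceMassHop_sq`: `det E_t = det(sliceMassHop U_t m)²` — exactly the Dirac-sea factor
  `(det A_red)² = e^{Tr P⁺ ln A}` of Smit's fermionic transfer operator `T̂_F(U_t) = (det A_red)² Γ(M_F(U_t))`
  (`fermionSliceOp`, Smit (6.91)), one per time slice.

References: M. Lüscher, Commun. Math. Phys. 54 (1977) 283 [Luscher1977, pp. 283–292]; J. Smit, *Introduction to
Quantum Fields on a Lattice*, §6.5 (6.91) [Smit2023].
-/

noncomputable section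

namespace Summit.QuantumFields.QCD.Cruxes.StableActionBridge.Sketch

open Matrix Literature.MathematicalPhysics.QuantumFieldTheory Literature.MathematicalPhysics.QuantumLattice
open Literature.Probability.LatticeModels (TorusSite)

namespace ChainBlockSmit

/-- The site-block-diagonal colour matrix of inverse `SU(3)` link variables (defining representation) has
determinant one. [folklore] -/
theorem det_invLinkBlock_eq_one {L : ℕ} [NeZero L] (g : TorusSite 3 L → Matrix.specialUnitaryGroup (Fin 3) ℂ) :
    (Matrix.of fun p q : TorusSite 3 L × Fin 3 =>
        if p.1 = q.1 then fundamentalRep (Fin 3) (g p.1)⁻¹ p.2 q.2 else 0).det = 1 := by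
  rw [APChainBlockPos.det_of_siteBlockDiag fun x : TorusSite 3 L => fundamentalRep (Fin 3) (g x)⁻¹]
  refine Finset.prod_eq_one fun x _ => ?_
  rw [fundamentalRep_apply]
  exact (Matrix.mem_specialUnitaryGroup_iff.1 ((g x)⁻¹).2).2

/-- The one-flavour slice block `B_t` of `wilson_det_transfer_form` is the reindexing of Smit's `sliceMassHop` of
the slice configuration along `Fin 1 × (site × colour) ≃ site × colour`. [cite: Smit2023, §6.5 (6.74)] -/
theorem sliceBlock_eq_reindex_sliceMassHop {L : ℕ} [NeZero L]
    (U : GaugeConfig 4 L (Matrix.specialUnitaryGroup (Fin 3) ℂ)) (m : ℝ) (t : ZMod L) :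
    (Matrix.of fun a b : TorusSite 3 L × Fin 3 =>
        (if a = b then ((m + 4 : ℝ) : ℂ) else 0) -
          (1 / 2 : ℂ) * ∑ j : Fin 3,
            ((if b.1 = Literature.MathematicalPhysics.QuantumFieldTheory.Site.shift a.1 j then
                fundamentalRep (Fin 3) (U ((Fin.cons t a.1 : TorusSite 4 L), j.succ)) a.2 b.2 else 0) +
              (if a.1 = Literature.MathematicalPhysics.QuantumFieldTheory.Site.shift b.1 j then
                fundamentalRep (Fin 3) (U ((Fin.cons t b.1 : TorusSite 4 L), j.succ))⁻¹ a.2 b.2 else 0))) =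
      Matrix.reindex (Equiv.uniqueProd (TorusSite 3 L × Fin 3) (Fin 1)) (Equiv.uniqueProd (TorusSite 3 L × Fin 3) (Fin 1))
        (sliceMassHop (fun e : Edge 3 L => U ((Fin.cons t e.1 : TorusSite 4 L), e.2.succ)) (fun _ : Fin 1 => m)) := by
  ext a b
  rw [Matrix.reindex_apply, Matrix.submatrix_apply, Equiv.uniqueProd_symm_apply, Equiv.uniqueProd_symm_apply,
    Matrix.of_apply]
  exact (sliceMassHop_timeSlice_apply L U m t a b).symm

end ChainBlockSmit

/-- **The chain-block prefactor is the square of Smit's Dirac-sea determinant** (registered sub-goal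
`det_chainBlock_eq_det_sliceMassHop_sq`): for an `SU(3)` gauge field `U` on `(ℤ/L)⁴`, a bare mass `m` and a time
`t`, the chain block `E_t = A_t P⁻ − P⁺ W′_{t−1}` of the time-slice reduction of `det D_W[U]` has
`det E_t = det(sliceMassHop U_t m)²`, `U_t` the slice configuration `(x⃗, j) ↦ U((t, x⃗), j+1)` — the factor
`(det A_red)²` of `T̂_F(U_t)` in Smit (6.91). [cite: Luscher1977, pp. 283–292] [cite: Smit2023, §6.5 (6.91)] -/
theorem det_chainBlock_eq_det_sliceMassHop_sq : ∀ (L : ℕ) [NeZero L] (U : GaugeConfig 4 L (Matrix.specialUnitaryGroup (Fin 3) ℂ)) (m : ℝ) (t : ZMod L), let Pp : Matrix (TorusSite 3 L × Fin 3 × Fin 4) (TorusSite 3 L × Fin 3 × Fin 4) ℂ := Matrix.of fun a b => if a.1 = b.1 ∧ a.2.1 = b.2.1 then ((1 / 2 : ℂ) • (1 + euclideanGamma 0)) a.2.2 b.2.2 else 0; let Pm : Matrix (TorusSite 3 L × Fin 3 × Fin 4) (TorusSite 3 L × Fin 3 × Fin 4) ℂ := Matrix.of fun a b => if a.1 = b.1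 ∧ a.2.1 = b.2.1 then ((1 / 2 : ℂ) • (1 - euclideanGamma 0)) a.2.2 b.2.2 else 0; let W' : ZMod L → Matrix (TorusSite 3 L × Fin 3 × Fin 4) (TorusSite 3 L × Fin 3 × Fin 4) ℂ := fun t => Matrix.of fun a b => if a.1 = b.1 ∧ a.2.2 = b.2.2 then fundamentalRep (Fin 3) (U ((Fin.cons t a.1 : TorusSite 4 L), 0))⁻¹ a.2.1 b.2.1 else 0; let A : ZMod L → Matrix (TorusSite 3 L × Fin 3 × Fin 4) (TorusSite 3 L × Fin 3 × Fin 4) ℂ := fun t => Matrix.of fun a b => (if a = b then ((m + 4 * 1 : ℝ) : ℂ) else 0) - (1 / 2 : ℂ) * ∑ j : Fin 3, ((if b.1 = Literature.MathematicalPhysics.QuantumFieldTheory.Site.shift a.1 j then (((1 : ℝ) : ℂ) • (1 : Matrix (Fin 4) (Fin 4) ℂ) - euclideanGamma j.succ) a.2.2 b.2.2 * fundamentalRep (Fin 3) (U ((Fin.cons t a.1 : TorusSite 4 L), j.succ)) a.2.1 b.2.1 else 0) + (if a.1 = Literature.MathematicalPhysics.QuantumFieldTheory.Site.shift b.1 j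 then (((1 : ℝ) : ℂ) • (1 : Matrix (Fin 4) (Fin 4) ℂ) + euclideanGamma j.succ) a.2.2 b.2.2 * fundamentalRep (Fin 3) (U ((Fin.cons t b.1 : TorusSite 4 L), j.succ))⁻¹ a.2.1 b.2.1 else 0)); (A t * Pm - Pp * W' (t - 1)).det = (sliceMassHop (fun e : Edge 3 L => U ((Fin.cons t e.1 : TorusSite 4 L), e.2.succ)) (fun _ : Fin 1 => m)).det ^ 2 := by
  intro L _ U m t Pp Pm W' A
  have h := det_wilson_chainBlock 3 L (Matrix.specialUnitaryGroup (Fin 3) ℂ) (fundamentalRep (Fin 3)) U m t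
  simp only at h
  rw [h, ChainBlockSmit.det_invLinkBlock_eq_one (fun x : TorusSite 3 L => U ((Fin.cons (t - 1) x : TorusSite 4 L), 0)),
    one_pow, one_mul, ChainBlockSmit.sliceBlock_eq_reindex_sliceMassHop U m t, Matrix.det_reindex_self]

end Summit.QuantumFields.QCD.Cruxes.StableActionBridge.Sketch

end
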